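import Literature.AlgebraicGeometry.Motives.GrassmannianUniversalQuotient
import Literature.AlgebraicGeometry.Motives.GrassmannianClassifyEpi
import Literature.AlgebraicGeometry.KTheory.GrothendieckGroup
import HarnessLib

/-!
# Rank-`k` quotients `𝒪_T^{(J)} ↠ Q` of the free module: the global frame and the classifying morphism

★ `Motives/GrassmannianClassifyEpi` classifies rank-`k` quotients `φ : P ↠ Q` of a GLOBALLY FRAMED module
(`e : 𝒪^J ≅ P|_T`, a frame over the over-site of `⊤`), with the generating sections `q_j := φ(e_j)`. Here we
supply the global frame of the free module `𝒪_T^{(J)} = freeModule T J` of ★ `Motives/GrassmannianUniversalQuotient`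
itself and identify its basis sections with the tautological sections `ε_j`:

* `freeModuleFrame T J U : 𝒪^J ≅ (𝒪_T^{(J)})|_U` — Mathlib `SheafOfModules.mapFreeIso` for the restriction functor
  to the opens over `U` (a left adjoint, ★ `overAdj`, hence preserving the coproduct `𝒪^{(J)} = ∐ 𝒪`);
* `basisSection_freeModuleFrame : basisSection (freeModuleFrame T J U) j = ε_j|_U` (`freeSectionOn T j U`);
* `existsUnique_hom_of_epi_freeModule` — **the classifying morphism `T ⟶ grassmannianScheme M k` of a rank-`k` quotient
  `φ : 𝒪_T ⊗ M = 𝒪_T^{(J)} ↠ Q`** (`b : J → M` a basis), with `q_j := φ(ε_j)`: ★ `existsUnique_hom_of_epi` made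
  unconditional in the frame ([GortzWedhorn2020, (8.4) (pp. 213–215)]: `Grass_k(M)(T)` = rank-`k` quotients of
  `𝒪_T ⊗ M`);
* for chart data `D` of a point `x ∈ Gr(T)` (★ `ChartData`): `quotientπ_app_basisSection_freeModuleFrame`
  (`π_x(e_j) = q_j`) and **`sectionsMap_quotientSection_surjective`: the sections maps `Γ(T, W) ⊗ M → Γ(𝒬_x, W)` are
  onto for EVERY affine open `W`** (★ `sectionsMap_surjective_of_epi` and `epi_quotientπ`), complementing the
  chart-local statement of ★ `GrassmannianUniversalQuotientClassify` (so the hypotheses `HasRank` + `hgen` of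
  ★ `existsUnique_hom_ker_sectionsMap` hold for `(𝒬_x, (q_j))`; its conclusion is ★ `existsUnique_hom_evalAffine_eq_ker`).

Everything is proved; no named facts.

## References

* U. Görtz, T. Wedhorn, *Algebraic Geometry I*, 2nd ed. (2020), (8.4) pp. 213–215; (7.4) p. 180. [GortzWedhorn2020]
* R. Hartshorne, *Algebraic Geometry*, GTM 52 (1977), II §5 (p. 109), II Prop. 5.6 (p. 113). [Hartshorne1977]
-/

noncomputable section

-- Mathlib's `Scheme.Modules` section API is stated across semireducible wrappers (as in Mathlib's own files).
set_option backward.isDefEq.respectTransparency false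

universe u

open CategoryTheory Opposite TensorProduct TopologicalSpace AlgebraicGeometry
-- `Scheme.Modules.overFunctor` / `overSectionsEquiv` live in the `…Motives` namespace (★ `ChernClassesProofs`)
open Literature.AlgebraicGeometry.Motives

namespace Literature.AlgebraicGeometry.Modules

variable (T : Scheme.{u}) (J : Type u)

/-- **The global frame of the free module**: `𝒪^J ≅ (𝒪_T^{(J)})|_U` over the opens of `U` — restriction to the
over-site is a left adjoint (★ `overAdj`), so it preserves the coproduct `𝒪_T^{(J)} = ∐_J 𝒪_T`, and it carries the
unit to the unit (Mathlib `SheafOfModules.mapFreeIso`). [cite: Hartshorne1977, II §5 (p. 109)] -/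
def freeModuleFrame (U : T.Opens) : SheafOfModules.free J ≅ (freeModule T J).over U :=
  haveI := (overAdj (X := T) U).leftAdjoint_preservesColimits
  SheafOfModules.mapFreeIso (Scheme.Modules.overFunctor (X := T) U) J (Iso.refl _)

variable {T J} in
/-- **The basis sections of the global frame are the tautological sections**: `e_j = ε_j|_U`.
[cite: Hartshorne1977, II §5 (p. 109)] -/
theorem basisSection_freeModuleFrame (U : T.Opens) (j : J) :
    basisSection (E := freeModule T J) (freeModuleFrame T J U) j = freeSectionOn T j U := by
  haveI := (overAdj (X := T) U).leftAdjoint_preservesColimits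
  rw [basisSection, Scheme.Modules.overSectionsEquiv_apply, Scheme.Modules.overSectionsEval_freeHomEquiv,
    freeModuleFrame, SheafOfModules.ιFree_mapFreeIso_hom, Iso.refl_hom, Category.id_comp]
  rfl

/-- The free module `𝒪_T^{(J)}` on a finite set `J` is affine-localizing (finite locally free,
★ `KZero.isFiniteLocallyFree_free`). [cite: Hartshorne1977, II Prop. 5.6 (p. 113)] -/
theorem isAffineLocalizing_freeModule [Finite J] : IsAffineLocalizing (freeModule T J) :=
  isAffineLocalizing_of_isFiniteLocallyFree (KTheory.KZero.isFiniteLocallyFree_free J)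

end Literature.AlgebraicGeometry.Modules

namespace Literature.AlgebraicGeometry.Motives.Grassmannian

open Literature.AlgebraicGeometry.Modules

variable {M : Type u} [AddCommGroup M] {k : ℕ} {J : Type u} (b : Module.Basis J ℤ M) {T : Scheme.{u}}

section Epi

variable (M k) [Fintype J] (Q : T.Modules) (φ : freeModule T J ⟶ Q) [Epi φ] [(grassmannianSheaf M k).obj.IsRepresentable]

/-- **The classifying morphism of a rank-`k` quotient `φ : 𝒪_T ⊗ M = 𝒪_T^{(J)} ↠ Q`**: there is a unique
`f : T ⟶ grassmannianScheme M k` with `evalAffine V (pointsEquiv f) = ker (Γ(T, V) ⊗ M → Γ(Q, V))`, `r ⊗ b_j ↦ r • φ(ε_j)|_V`,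
on every affine open `V` (★ `existsUnique_hom_of_epi` in the global frame `freeModuleFrame T J ⊤`).
[cite: GortzWedhorn2020, (8.4) (pp. 213–215)] [cite: StacksProject, Tag 089R] -/
theorem existsUnique_hom_of_epi_freeModule (hQ : HasRank Q k) :
    ∃! f : T ⟶ grassmannianScheme M k, ∀ V : T.affineOpens,
      (evalAffine V.2 (pointsEquiv M k T f)).toSubmodule =
        LinearMap.ker (sectionsMap b Q (fun j => φ.app ⊤ (freeSectionOn T j ⊤)) V) := by
  have h := existsUnique_hom_of_epi M k b Q (freeModuleFrame T J ⊤) φ (isAffineLocalizing_freeModule T J) hQ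
  simp only [basisSection_freeModuleFrame] at h
  exact h

end Epi

namespace ChartData

variable {b} {x : (grassmannianSheaf M k).obj.obj (op T)} {ι : Type u} (D : ChartData b x ι)

/-- `π_x` maps the basis sections of the global frame to the `q_j`: `π_x(e_j) = q_j`.
[cite: GortzWedhorn2020, (8.4) (pp. 213–215)] -/
theorem quotientπ_app_basisSection_freeModuleFrame (j : J) :
    D.quotientπ.app ⊤ (basisSection (E := freeModule T J) (freeModuleFrame T J ⊤) j) = D.quotientSection j := by
  rw [basisSection_freeModuleFrame, quotientπ_app_freeSectionOn]
  have h : (homOfLE (le_top : (⊤ : T.Opens) ≤ ⊤)).op = 𝟙 (op ⊤) := Subsingleton.elim _ _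
  rw [h, D.quotientModule.presheaf.map_id]
  rfl

/-- **The sections maps `θ_W : Γ(T, W) ⊗ M → Γ(𝒬_x, W)` of the quotient of chart data are onto for EVERY affine open
`W`** when the charts cover `T` (`J` finite): `π_x : 𝒪_T^{(J)} ↠ 𝒬_x` is an epimorphism of affine-localizing modules
(★ `epi_quotientπ`), so it is onto over affine opens ([Hartshorne1977, II Prop. 5.6]), and every section of `𝒪_T^{(J)}`
over `W` is a combination of the `ε_j|_W` (★ `sectionsMap_surjective_of_epi` in the global frame).
[cite: GortzWedhorn2020, (8.4) (pp. 213–215)] [cite: Hartshorne1977, II Prop. 5.6 (p. 113)] -/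
theorem sectionsMap_quotientSection_surjective [Fintype J] (hcov : ∀ t : T, ∃ a, t ∈ D.U a) {W : T.Opens}
    (hW : IsAffineOpen W) : Function.Surjective (sectionsMap b D.quotientModule D.quotientSection W) := by
  haveI := D.epi_quotientπ hcov
  have h := sectionsMap_surjective_of_epi b D.quotientModule (freeModuleFrame T J ⊤) D.quotientπ
    (isAffineLocalizing_freeModule T J)
    (isAffineLocalizing_of_isFiniteLocallyFree (D.cocycle.isFiniteLocallyFree_glued hcov)) hW
  have hq : (fun j => D.quotientπ.app ⊤ (basisSection (E := freeModule T J) (freeModuleFrame T J ⊤) j)) =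
      D.quotientSection := funext D.quotientπ_app_basisSection_freeModuleFrame
  rwa [hq] at h

end ChartData

end Literature.AlgebraicGeometry.Motives.Grassmannian

end
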